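/-
Copyright (c) 2026 the pub-hodgecm-mathlib formalisation cell (harness21).  Prover seat hodgecm-mathlib-LH4-p12 (g8), req620 Track A «(D-RAM) FOUR-FRAME» squad
((β₂) road (R-36), β₂-BOARD row (L-Σ), dealer WORD #129 (iv): «THE PER-LITERAL AXIS-COLUMN INSTANCES of ★ p862003 (AX-0)»), 2026-09-04.
-/
import Summits.HodgeConjecture.HodgeConjecture.Theorems.F0P3cDyRamAxisColumnZero              -- ★ p862003 (this seat): (AX-0) `natCast_ncard_axisCell_plus_sub_cleanMinus_eq_zero`; brings ★ `isOrd_mul`, ★ `mapGL_endoGL_latt_endoGL_eq_iff`, ★ `isSelfDualLattice_latt_endoGL_one_iff`, the line-model kit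
import Summits.HodgeConjecture.HodgeConjecture.Theorems.F0P3cDyRamCleanLevelOfKernelCHBlock      -- ★ p861941 (LH4-p04 (g8)): (α′)₂ `latticeInLevel_sq_endoGL_of_shell_of_valueSet_eq_of_formCongr` (the `hclean` dictionary)
import Summits.HodgeConjecture.HodgeConjecture.Theorems.F0P3cDyRamConeWeightHalfSplit           -- ★ (LH4-p12 (g4)) ED. 2: `exists_flipUnit_of_forall_fixed_fixed_isNorm` (the ω-flip `(z, ξ)` from `hFN`)
import Literature.NumberTheory.Automorphic.EllipticPlaneAsFieldLine                              -- ★ (C): `dualLatt_eq_of_forall_herm_iff_mem`; brings ★ (D3) `mapGL_eq_iff_forall_mul_mem`, `inv_mem_order_of_mem_order`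
import Literature.NumberTheory.Automorphic.UnitaryLatticeTreeTubeAxisVertex                      -- ★ `isSelfDualLattice_latt_of_dualLatt_eq`
import Literature.NumberTheory.Automorphic.UnitaryGroupFormCongrFinSum                           -- ★ `formCongr_one_eq`
import Literature.NumberTheory.Automorphic.UnitaryLatticeTreeSelfDualTransitiveTwo                -- ★ `det_antidiagonal_two`
import HarnessLib

/-!
# Crux `H413`, line LH4 «(D-RAM) FOUR-FRAME» — STAGE-1b, row (2) of `f_{T₊}`, the (β₂) road «PURE-CELL LEDGER» (R-36): β₂-BOARD row (L-Σ), dealer WORD #129 (iv)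
# «THE AXIS COLUMN OF A TYPE-(2) LITERAL SUMS TO ZERO, FROM THE FRAME LETTERS» — ★ p862003 (AX-0) with its ω-flip `ε` and its `hclean` dictionary DISCHARGED

Cell `hodgecm-mathlib` (D-0151), FLOOR 0, crux item H413 = `stmt-HodgeConjecture-24833`, route of record `HCCMUnconditional`; squad F0∕P3c∕LH4; lane
`--supports stmt-HodgeConjecture-24833 --as helper` (count-neutral; pays NO tier-0 row).  THEOREMS ONLY (no `def`, no instance, no notation, no `sorry`, default heartbeats);
★-only imports; states NO law; (β₂) and the three framed cells letters stay HYPOTHESES.  DATUM-FREE over ★ (C1)'s block-frame binders — both literals at once (generic `(H₂, h_W)`),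
plus the hyperbolic literal spelled out (§4).

WHY (β₂-BOARD sub-dealer LH4-p04 (g8) HANDOFF-beta2cells v1 (61f6486f) §«What the next seat does»; dealer WORD #129 (iv)).  In the cell currency of ★ p861305 §3 the three framed
leaves `beta2Cells{A,B,C}Frame` ask, per literal, `cellSum_HYP = cellSum_ANISO`, where each `cellSum` opens with the AXIS COLUMN
`Σ_{j<J+1} [lam ∈ 𝒪_j]·(#(levelSet(j,0) ∩ q₀₊) − #(levelSet(j,0) ∩ q₀₋′))`.  ★ p862003 (AX-0) kills every axis cell GIVEN an ω-flip `ε` (`ε·Θε = jE ξ`, `ξ` a fixed non-norm unit)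
and two per-cell dictionary hypotheses `hclean` ((α′)-shape) and `hdich` ((A″)-shape).  THIS FILE turns (AX-0) into the ROW the (L-Σ-3) lane assemblers plug in:
* §1 THE AXIS VERTEX OVER A CELL MEMBER IS A FIXED SELF-DUAL VERTEX: for `φ(latt g₂) ∈ levelSet(j, 0)` the vertex `latt ι(g₂, 1)` is SELF-DUAL for the block form (the dual
  generator `Y` is a unit of `𝒪_j`, so `Λ^# = Y⁻¹Λ = Λ`: ★ DEFS `forall_mem_herm_iff_exists`, ★ (C) `dualLatt_eq_of_forall_herm_iff_mem`, ★ `isSelfDualLattice_latt_of_dualLatt_eq`,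
  ★ `isSelfDualLattice_latt_endoGL_one_iff`) and, when `lam ∈ 𝒪_j` and `|u₀₀| = 1`, FIXED by `Γ = ι(γ₂, u)` (★ (D3) `mapGL_eq_iff_forall_mul_mem`, ★ `mapGL_endoGL_latt_endoGL_eq_iff`);
* §2 `hclean` DISCHARGED from the two «deep near 1» letters `hs : |tr γ₂ − 2|·|ϖ^{ℓ₀}| ≤ |ϖ^{m_c}|`, `hp : |χ_{γ₂}(1)| ≤ |ϖ^{m_c}|` of ★ `beta2CellsBNear` ∕ `…CFrame` ∕ `…AFrame`
  and the frame `formCongr σ P₁ Φ₃ = H`, `P₁ Γ P₁⁻¹ ∈ U(σ, Φ₃)` — ★ p861941 (α′)₂ `latticeInLevel_sq_endoGL_of_shell_of_valueSet_eq_of_formCongr` fed with §1;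
* §3 HEAD `sum_ite_isOrd_axisCellDiff_eq_zero_of_frame`: the ω-flip from the type-free token `hFN` («every `(ρ, Θ)`-fixed unit of `M` is a `Θ`-norm», ★
  `exists_flipUnit_of_forall_fixed_fixed_isNorm`; at the CM place `hFN` is ★ `F0P3cDyRamFlipUnitToken.exists_mul_theta_eq_of_fixed_fixed`), `hclean` from §2, `m* ≤ m_c` by ★
  `mstarOfRecord_le_mcOfRecord`, and (AX-0) cell by cell ⇒ **the whole axis column of the literal is `0`**, MODULO ONE named per-level hypothesis family `hdich` ((A″)-on-axis: on a
  FIXED SELF-DUAL axis vertex of an `𝒪_j`-cell with `lam ∈ 𝒪_j` that lies on the clean `(ℓ₀, m_c)`-shell, the `m*`-letter is ONE class `valueSetMod σ ϖ m* (e • X₊)`, `e` a `σ`-fixed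
  unit) — its deep-order instance is ★ p862010's leading-norm set (LH4-p13), its shallow-order instance the (AX) face (LH4-p15 (g0), in flight); both plug into `hdich` as stated;
* §4 the HYPERBOLIC literal (`H₂ = Φ₂`, `h_W = 1`, `P₁ = 1`): `sum_ite_isOrd_axisCellDiff_eq_zero_hyp`.
HONEST LABEL.  Count-neutral lattice ∕ norm-class bookkeeping; nothing printed is asserted; no census law is stated; (β₂), the framed cells letters and `hdich` stay HYPOTHESES;
`HC_CM` is proved only modulo the 7 printed citations (2 remaining named inputs: hLiu418 = `stmt-HodgeConjecture-24832`, h413 = `stmt-HodgeConjecture-24833`) until rung 0 closes.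
## References
* [Kottwitz1986BaseChangeUnits] R. E. Kottwitz, *Base change for unit elements of Hecke algebras*, Compositio Math. 60 (1986): §1 pp. 240–241 (signed lattice counts, cell by cell).
* [Rogawski1990] J. D. Rogawski, *Automorphic Representations of Unitary Groups in Three Variables*, Ann. of Math. Stud. 123 (1990): §4.9 Prop. 4.9.1 (b) p. 55 (the labelled census of `f_{T₊}`).
* [Jacobowitz1962] R. Jacobowitz, *Hermitian forms over local fields*, Amer. J. Math. 84 (1962): §4, §7 (hermitian lattices over orders, duals, unimodular lattices).
* [BruhatTits1972] F. Bruhat, J. Tits, *Groupes réductifs sur un corps local I*, Publ. Math. IHÉS 41 (1972): §10 (lattice models of rank-one groups).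
* [Serre1979] J.-P. Serre, *Local Fields*, GTM 67 (1979): Ch. V §3 Cor. 3 (norm classes of units: index two).
-/

set_option autoImplicit false

noncomputable section

namespace Summit.HodgeConjecture.HodgeConjecture.Cruxes.H413.F0P3cDyRamAxisColumnZeroOfFrame

open scoped Valued WithZero Matrix MatrixGroups Pointwise Classical
open WithZero
open Literature.NumberTheory.Automorphic Literature.NumberTheory.Automorphic.HermitianLattice Literature.NumberTheory.Automorphic.UnitaryLatticeTree
open Literature.NumberTheory.Automorphic.UnitaryGroup (formCongr_one_eq)
open Literature.NumberTheory.Automorphic.UnitaryThreeFourFrame (IsRamifiedQuadraticDatum)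
open Literature.NumberTheory.Automorphic.EllipticPlaneAsFieldLine
open Literature.NumberTheory.Rogawski1990
open Summit.HodgeConjecture.HodgeConjecture.Cruxes.H413.F0P3cDyRamFourFramePieces
open Summit.HodgeConjecture.HodgeConjecture.Cruxes.H413.F0P3cDyRamFourFrameCensusDefs (LatticeInLevel LatticeNearTransvShell)
open Summit.HodgeConjecture.HodgeConjecture.Cruxes.H413.F0P3cDyRamStageOneBDefs (mcOfRecord mstarOfRecord_le_mcOfRecord)
open Summit.HodgeConjecture.HodgeConjecture.Cruxes.H413.F0P3cDyRamToricCensusDefs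
open Summit.HodgeConjecture.HodgeConjecture.Cruxes.H413.F0P3cDyRamShellLineModel (isOrd_mul)
open Summit.HodgeConjecture.HodgeConjecture.Cruxes.H413.F0P3cDyRamCleanLevelOfKernelCHBlock (latticeInLevel_sq_endoGL_of_shell_of_valueSet_eq_of_formCongr)
open Summit.HodgeConjecture.HodgeConjecture.Cruxes.H413.F0P3cDyRamConeWeightHalfSplit (exists_flipUnit_of_forall_fixed_fixed_isNorm)
open Summit.HodgeConjecture.HodgeConjecture.Cruxes.H413.F0P3cDyRamAxisColumnZero (natCast_ncard_axisCell_plus_sub_cleanMinus_eq_zero)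

variable {E : Type} {M : Type*} [Field E] [Valued E ℤᵐ⁰] [Field M] [Valued M ℤᵐ⁰] {σ : E →+* E} {ϖ : E} {d t : ℕ} {ρ Θ : M →+* M} {α : M}

/-! ## §1 The axis vertex over a cell member is a fixed self-dual vertex -/

/-- **`lam ∈ 𝒪_j` ⇒ THE AXIS VERTEX OVER AN `𝒪_j`-CELL MEMBER IS FIXED BY `Γ = ι(γ₂, u)`** (`|u₀₀| = 1`): `Λ = φ(latt g₂) = x₀·𝒪_j` is `lam`-stable (★ `isOrd_mul`), so `γ₂·latt g₂ = latt g₂`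
(★ (D3) `mapGL_eq_iff_forall_mul_mem`), so `ι(γ₂, u)·latt ι(g₂, 1) = latt ι(g₂, 1)` (★ `mapGL_endoGL_latt_endoGL_eq_iff`). [cite: BruhatTits1972, §10] [cite: Kottwitz1986BaseChangeUnits, §1 pp. 240–241] -/
theorem mapGL_endoGL_latt_endoGL_one_eq_of_isOrd (jE : E →+* M)
    (hρρ : ∀ x, ρ (ρ x) = x) (hvρ : ∀ x, Valued.v (ρ x) = Valued.v x) (hα : ρ α ≠ α) (hα1 : Valued.v α ≤ 1)
    (hint : ∀ z : M, Valued.v z ≤ 1 → Valued.v ((z - ρ z) / (α - ρ α)) ≤ 1)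
    (hjv : ∀ c, Valued.v (jE c) ≤ 1 ↔ Valued.v c ≤ 1) (hjfix : ∀ z, ρ z = z ↔ ∃ c, jE c = z)
    (φ : (Fin 2 → E) →+ M) (hφs : ∀ (c : E) (x : Fin 2 → E), φ (c • x) = jE c * φ x) (hφi : Function.Injective φ)
    {γ₂ : GL (Fin 2) E} {lam h : M} (hφγ : ∀ x, φ ((γ₂ : Matrix (Fin 2) (Fin 2) E).mulVec x) = lam * φ x) (hlam : Valued.v lam = 1)
    (u : GL (Fin 1) E) (hu1 : Valued.v ((u : Matrix (Fin 1) (Fin 1) E) 0 0) = 1)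
    {j a : ℕ} (hord : IsOrd ρ α (jE ϖ ^ j) lam)
    {g₂ : GL (Fin 2) E} (hmem : (latt (g₂ : Matrix (Fin 2) (Fin 2) E)).toAddSubgroup.map φ ∈ levelSet ρ Θ α (jE ϖ) h j a) :
    mapGL (endoGL (γ₂, u)) (latt ((endoGL (g₂, (1 : GL (Fin 1) E)) : GL (Fin 3) E) : Matrix (Fin 3) (Fin 3) E)) =
      latt ((endoGL (g₂, (1 : GL (Fin 1) E)) : GL (Fin 3) E) : Matrix (Fin 3) (Fin 3) E) := by
  refine (mapGL_endoGL_latt_endoGL_eq_iff g₂ γ₂ u).2 ⟨(mapGL_eq_iff_forall_mul_mem jE hρρ hvρ hα hα1 hint hjv hjfix φ hφs hφi hφγ hlam g₂).2 ?_, hu1⟩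
  obtain ⟨x₀, -, hΛ, -, -, -⟩ := (mem_levelSet_iff ρ Θ α (jE ϖ) h j a _).1 hmem
  intro x hx
  obtain ⟨z, hz, rfl⟩ := (hΛ x).1 hx
  exact (hΛ _).2 ⟨lam * z, isOrd_mul hvρ hord hz, by ring⟩

/-- **THE AXIS VERTEX OVER A LEVEL-`0` CELL MEMBER IS SELF-DUAL FOR THE BLOCK FORM.**  If `φ(latt g₂) = Λ ∈ levelSet ρ Θ α (jE ϖ) h j 0` — `Λ = x₀·𝒪_j` with dual generator `Y ∈ 𝒪_j`
of valuation `|jE ϖ|^0 = 1`, hence `Y⁻¹ ∈ 𝒪_j` too (★ `inv_mem_order_of_mem_order`) and `Λ^# = Y⁻¹Λ = Λ` (★ DEFS `forall_mem_herm_iff_exists`) — then `latt g₂` is its own `H₂`-dual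
(★ (C) `dualLatt_eq_of_forall_herm_iff_mem`), so SELF-DUAL (★ `isSelfDualLattice_latt_of_dualLatt_eq`), and so is `latt ι(g₂, 1)` for the block form `H = ι-shape(H₂, h_W)`, `|h_W| = 1`
(★ `isSelfDualLattice_latt_endoGL_one_iff`). [cite: Jacobowitz1962, §4, §7] [cite: BruhatTits1972, §10] -/
theorem isSelfDualLattice_latt_endoGL_one_of_mem_levelSet_zero (hvσ : ∀ a, Valued.v (σ a) = Valued.v a) (hϖ0 : ϖ ≠ 0) (hϖ1 : Valued.v ϖ ≤ 1)
    {H₂ : Matrix (Fin 2) (Fin 2) E} (hH₂ : IsUnit H₂.det) {hW : E} (hhW : Valued.v hW = 1) (jE : E →+* M)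
    (hρρ : ∀ x, ρ (ρ x) = x) (hvρ : ∀ x, Valued.v (ρ x) = Valued.v x) (hα : ρ α ≠ α) (hα1 : Valued.v α ≤ 1)
    (hint : ∀ z : M, Valued.v z ≤ 1 → Valued.v ((z - ρ z) / (α - ρ α)) ≤ 1)
    (hΘΘ : ∀ x, Θ (Θ x) = x) (hΘρ : ∀ x, Θ (ρ x) = ρ (Θ x)) (hvΘ : ∀ x, Valued.v (Θ x) = Valued.v x)
    (hjv : ∀ c, Valued.v (jE c) ≤ 1 ↔ Valued.v c ≤ 1) (hjfix : ∀ z, ρ z = z ↔ ∃ c, jE c = z)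
    (φ : (Fin 2 → E) →+ M) (hφi : Function.Injective φ)
    {h : M} (hh : h ≠ 0) (hform : ∀ x y, jE (pairing σ H₂ x y) = h * Θ (φ x) * φ y + ρ (h * Θ (φ x) * φ y))
    {j : ℕ} {g₂ : GL (Fin 2) E} (hmem : (latt (g₂ : Matrix (Fin 2) (Fin 2) E)).toAddSubgroup.map φ ∈ levelSet ρ Θ α (jE ϖ) h j 0) :
    IsSelfDualLattice σ ϖ (!![H₂ 0 0, 0, H₂ 0 1; 0, hW, 0; H₂ 1 0, 0, H₂ 1 1] : Matrix (Fin 3) (Fin 3) E)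
      (latt ((endoGL (g₂, (1 : GL (Fin 1) E)) : GL (Fin 3) E) : Matrix (Fin 3) (Fin 3) E)) := by
  obtain ⟨x₀, hx₀, hΛ, hYO, -, hYv⟩ := (mem_levelSet_iff ρ Θ α (jE ϖ) h j 0 _).1 hmem
  -- the order parameter `cc = (jE ϖ)^j`
  have hc : ρ (jE ϖ ^ j) = jE ϖ ^ j := by rw [← map_pow]; exact (hjfix _).2 ⟨ϖ ^ j, rfl⟩
  have hc0 : jE ϖ ^ j ≠ 0 := pow_ne_zero j ((map_ne_zero jE).2 hϖ0)
  have hc1 : Valued.v (jE ϖ ^ j) ≤ 1 := by rw [map_pow]; exact pow_le_one₀ zero_le ((hjv ϖ).2 hϖ1)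
  set Y : M := dualGen ρ Θ α (jE ϖ ^ j) h x₀ with hYdef
  have hY1 : Valued.v Y = 1 := by rw [hYv, pow_zero]
  have hY0 : Y ≠ 0 := fun h0 => by rw [h0, map_zero] at hY1; exact zero_ne_one hY1
  have hYinv : IsOrd ρ α (jE ϖ ^ j) Y⁻¹ := inv_mem_order_of_mem_order hρρ hvρ hY1 hYO
  -- `Λ^# = Λ`
  have hself : ∀ m, (∀ a ∈ (latt (g₂ : Matrix (Fin 2) (Fin 2) E)).toAddSubgroup.map φ, Valued.v (h * Θ a * m + ρ (h * Θ a * m)) ≤ 1) ↔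
      m ∈ (latt (g₂ : Matrix (Fin 2) (Fin 2) E)).toAddSubgroup.map φ := fun m => by
    rw [forall_mem_herm_iff_exists hρρ hvρ hα hα1 hint hΘΘ hΘρ hvΘ hc hc0 hc1 hh hx₀ hΛ m, hΛ m, ← hYdef]
    constructor
    · rintro ⟨z, hz, rfl⟩
      exact ⟨Y⁻¹ * z, isOrd_mul hvρ hYinv hz, by ring⟩
    · rintro ⟨z, hz, rfl⟩
      exact ⟨Y * z, isOrd_mul hvρ hYO hz, by rw [show Y⁻¹ * (x₀ * (Y * z)) = (Y⁻¹ * Y) * (x₀ * z) by ring, inv_mul_cancel₀ hY0, one_mul]⟩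
  exact (isSelfDualLattice_latt_endoGL_one_iff σ hvσ hϖ0 hϖ1 H₂ hhW g₂).2
    (isSelfDualLattice_latt_of_dualLatt_eq σ hvσ hϖ0 hϖ1 hH₂ g₂ (dualLatt_eq_of_forall_herm_iff_mem σ H₂ jE ρ Θ h hjv φ hφi hform hself))

/-! ## §2 `hclean` discharged: (α′)₂ on an axis cell, from the frame and the two «deep near 1» letters -/

/-- **`hclean` ON AN AXIS CELL, FROM THE FRAME LETTERS.**  Ramified quadratic datum; block form `H = ι-shape(H₂, h_W) = formCongr σ P₁ Φ₃` with `P₁·ι(γ₂, u)·P₁⁻¹ ∈ U(σ, Φ₃)`,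
`|h_W| = 1`, `H₂` non-degenerate; line model `(M, jE, ρ, Θ, α; φ, lam, h)`; `|u₀₀| = 1`; the two «deep near 1» letters `hs`, `hp` (`m_c = mcOfRecord d`); a level `j` with `lam ∈ 𝒪_j`.
THEN for every axis-cell member `φ(latt g₂) ∈ levelSet(j, 0)`: on the `(ℓ₀, m*)`-shell with `m*`-letter `V₊` the vertex `latt ι(g₂, 1)` is CLEAN at `m_c` (`(Γ−1)²·L ⊆ ϖ^{m_c}·L`) —
★ p861941 (α′)₂ `…_of_formCongr` at the fixed self-dual vertex of §1; this is the `hclean` binder of ★ p862003 at `(ℓ, m_c, a) = (d % 2, mcOfRecord d, 0)`.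
[cite: Rogawski1990, §4.9 Prop. 4.9.1 (b) p. 55] [cite: Kottwitz1986BaseChangeUnits, §1 pp. 240–241] -/
theorem hclean_axis_of_frame (hD : IsRamifiedQuadraticDatum σ ϖ d t)
    {H₂ : Matrix (Fin 2) (Fin 2) E} (hH₂ : IsUnit H₂.det) {hW : E} (hhW : Valued.v hW = 1) (jE : E →+* M)
    (hρρ : ∀ x, ρ (ρ x) = x) (hvρ : ∀ x, Valued.v (ρ x) = Valued.v x) (hα : ρ α ≠ α) (hα1 : Valued.v α ≤ 1)
    (hint : ∀ z : M, Valued.v z ≤ 1 → Valued.v ((z - ρ z) / (α - ρ α)) ≤ 1)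
    (hΘΘ : ∀ x, Θ (Θ x) = x) (hΘρ : ∀ x, Θ (ρ x) = ρ (Θ x)) (hvΘ : ∀ x, Valued.v (Θ x) = Valued.v x)
    (hjv : ∀ c, Valued.v (jE c) ≤ 1 ↔ Valued.v c ≤ 1) (hjfix : ∀ z, ρ z = z ↔ ∃ c, jE c = z)
    (φ : (Fin 2 → E) →+ M) (hφs : ∀ (c : E) (x : Fin 2 → E), φ (c • x) = jE c * φ x) (hφi : Function.Injective φ)
    {γ₂ : GL (Fin 2) E} {lam h : M} (hφγ : ∀ x, φ ((γ₂ : Matrix (Fin 2) (Fin 2) E).mulVec x) = lam * φ x) (hlam : Valued.v lam = 1)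
    (hh : h ≠ 0) (hform : ∀ x y, jE (pairing σ H₂ x y) = h * Θ (φ x) * φ y + ρ (h * Θ (φ x) * φ y))
    (u : GL (Fin 1) E) (hu1 : Valued.v ((u : Matrix (Fin 1) (Fin 1) E) 0 0) = 1)
    (P₁ : GL (Fin 3) E) (hA : formCongr σ P₁ ((StdForm.antidiagonal 3).over E) = (!![H₂ 0 0, 0, H₂ 0 1; 0, hW, 0; H₂ 1 0, 0, H₂ 1 1] : Matrix (Fin 3) (Fin 3) E))
    (hΓ : P₁ * endoGL (γ₂, u) * P₁⁻¹ ∈ unitaryGroupOfForm σ ((StdForm.antidiagonal 3).over E))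
    (hs : Valued.v ((γ₂ : Matrix (Fin 2) (Fin 2) E).trace - 2) * Valued.v (ϖ ^ (d % 2)) ≤ Valued.v (ϖ ^ mcOfRecord d))
    (hp : Valued.v ((γ₂ : Matrix (Fin 2) (Fin 2) E).det - (γ₂ : Matrix (Fin 2) (Fin 2) E).trace + 1) ≤ Valued.v (ϖ ^ mcOfRecord d))
    {j : ℕ} (hord : IsOrd ρ α (jE ϖ ^ j) lam) :
    ∀ g₂ : GL (Fin 2) E, (latt (g₂ : Matrix (Fin 2) (Fin 2) E)).toAddSubgroup.map φ ∈ levelSet ρ Θ α (jE ϖ) h j 0 →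
      LatticeNearTransvShell ϖ (d % 2) (mstarOfRecord d) ((((endoGL (γ₂, u) : GL (Fin 3) E) : Matrix (Fin 3) (Fin 3) E) - 1))
        (latt ((endoGL (g₂, (1 : GL (Fin 1) E)) : GL (Fin 3) E) : Matrix (Fin 3) (Fin 3) E)) →
      {z : E | ∃ y ∈ latt ((endoGL (g₂, (1 : GL (Fin 1) E)) : GL (Fin 3) E) : Matrix (Fin 3) (Fin 3) E), Valued.v ((ϖ ^ (mstarOfRecord d))⁻¹ * (z - pairing σ (!![H₂ 0 0, 0, H₂ 0 1; 0, hW, 0; H₂ 1 0, 0, H₂ 1 1] : Matrix (Fin 3) (Fin 3) E) y (((((endoGL (γ₂, u) : GL (Fin 3) E) : Matrix (Fin 3) (Fin 3) E) - 1)) *ᵥ y))) ≤ 1} = valueSetMod σ ϖ (mstarOfRecord d) (xPlus σ ϖ d) →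
      LatticeInLevel ϖ (mcOfRecord d) (((((endoGL (γ₂, u) : GL (Fin 3) E) : Matrix (Fin 3) (Fin 3) E) - 1)) * ((((endoGL (γ₂, u) : GL (Fin 3) E) : Matrix (Fin 3) (Fin 3) E) - 1)))
        (latt ((endoGL (g₂, (1 : GL (Fin 1) E)) : GL (Fin 3) E) : Matrix (Fin 3) (Fin 3) E)) := by
  have hvσ : ∀ a, Valued.v (σ a) = Valued.v a := hD.2.1
  have hϖ : Valued.v ϖ = exp (-1 : ℤ) := hD.2.2.1
  have hvϖ0 : Valued.v ϖ ≠ 0 := by rw [hϖ]; exact exp_ne_zero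
  have hϖ0 : ϖ ≠ 0 := fun h0 => by rw [h0, map_zero] at hvϖ0; exact hvϖ0 rfl
  have hϖ1 : Valued.v ϖ ≤ 1 := by rw [hϖ, ← exp_zero, exp_le_exp]; norm_num
  intro g₂ hmem hsh hV
  exact latticeInLevel_sq_endoGL_of_shell_of_valueSet_eq_of_formCongr hD P₁ hA γ₂ u hΓ
    (isSelfDualLattice_latt_endoGL_one_of_mem_levelSet_zero hvσ hϖ0 hϖ1 hH₂ hhW jE hρρ hvρ hα hα1 hint hΘΘ hΘρ hvΘ hjv hjfix φ hφi hh hform hmem)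
    (mapGL_endoGL_latt_endoGL_one_eq_of_isOrd jE hρρ hvρ hα hα1 hint hjv hjfix φ hφs hφi hφγ hlam u hu1 hord hmem) hsh hV hs hp

/-! ## §3 HEAD — the axis column of a literal sums to zero -/

/-- **(AX-Σ) «THE AXIS COLUMN OF A TYPE-(2) LITERAL SUMS TO ZERO, FROM THE FRAME LETTERS».**  Frame: ★ (C1)'s block-frame binders (`E` complete with finite residue field carrying
the ramified quadratic datum `hD`; block form `H = ι-shape(H₂, h_W) = formCongr σ P₁ Φ₃`, `H₂` non-degenerate, `|h_W| = 1`; block element `Γ = ι(γ₂, u)` with `P₁ Γ P₁⁻¹ ∈ U(σ, Φ₃)`,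
`|u₀₀| = 1`, `|u₀₀ − 1| ≤ |ϖ^{m*}|`, and the two «deep near 1» letters `hs hp`; line model `(M, jE, ρ, Θ, α; φ, lam, h)` with `Θ ∘ jE = jE ∘ σ`, `|lam| = 1`), the TYPE-FREE flip token
`hFN` (every `(ρ, Θ)`-fixed unit of `M` is `z·Θz`), and the ONE remaining per-level hypothesis family `hdich` ((A″)-on-axis, stated on FIXED SELF-DUAL axis vertices of `𝒪_j`-cells with
`lam ∈ 𝒪_j` lying on the clean `(ℓ₀, m_c)`-shell).  THEN, in the cell currency of ★ p861305 §3 ∕ the framed cells letters (`ℓ₀ = d % 2`, `m* = mstarOfRecord d`, `m_c = mcOfRecord d`),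
`Σ_{j < J+1} [IsOrd (jE ϖ)^j lam]·(#(levelSet(j,0) ∩ q₀₊) − #(levelSet(j,0) ∩ q₀₋′)) = 0`.  Proof: the ω-flip `(z, ξ)` from `hFN` (★ `exists_flipUnit_of_forall_fixed_fixed_isNorm`),
`hclean` from §2, `m* ≤ m_c` (★), and ★ p862003 (AX-0) on every summand.
[cite: Kottwitz1986BaseChangeUnits, §1 pp. 240–241] [cite: Rogawski1990, §4.9 Prop. 4.9.1 (b) p. 55] [cite: Serre1979, Ch. V §3 Cor. 3] [cite: Jacobowitz1962, §4, §7] -/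
theorem sum_ite_isOrd_axisCellDiff_eq_zero_of_frame [CompleteSpace E] [Finite 𝓀[E]] (hD : IsRamifiedQuadraticDatum σ ϖ d t)
    {H₂ : Matrix (Fin 2) (Fin 2) E} (hH₂ : IsUnit H₂.det) {hW : E} (hhW : Valued.v hW = 1) (jE : E →+* M)
    (hρρ : ∀ x, ρ (ρ x) = x) (hvρ : ∀ x, Valued.v (ρ x) = Valued.v x) (hα : ρ α ≠ α) (hα1 : Valued.v α ≤ 1)
    (hint : ∀ z : M, Valued.v z ≤ 1 → Valued.v ((z - ρ z) / (α - ρ α)) ≤ 1)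
    (hΘΘ : ∀ x, Θ (Θ x) = x) (hΘρ : ∀ x, Θ (ρ x) = ρ (Θ x)) (hvΘ : ∀ x, Valued.v (Θ x) = Valued.v x) (hΘj : ∀ x, Θ (jE x) = jE (σ x))
    (hjv : ∀ c, Valued.v (jE c) ≤ 1 ↔ Valued.v c ≤ 1) (hjfix : ∀ z, ρ z = z ↔ ∃ c, jE c = z)
    (hjpow : ∀ (t : E) (n : ℤ), Valued.v (jE t) = Valued.v (jE ϖ) ^ n ↔ Valued.v t = Valued.v ϖ ^ n)
    (φ : (Fin 2 → E) →+ M) (hφs : ∀ (c : E) (x : Fin 2 → E), φ (c • x) = jE c * φ x) (hφi : Function.Injective φ) (hφo : Function.Surjective φ)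
    {γ₂ : GL (Fin 2) E} {lam h : M} (hφγ : ∀ x, φ ((γ₂ : Matrix (Fin 2) (Fin 2) E).mulVec x) = lam * φ x) (hlam : Valued.v lam = 1)
    (hh : h ≠ 0) (hform : ∀ x y, jE (pairing σ H₂ x y) = h * Θ (φ x) * φ y + ρ (h * Θ (φ x) * φ y))
    (u : GL (Fin 1) E) (hu1 : Valued.v ((u : Matrix (Fin 1) (Fin 1) E) 0 0) = 1) (hum : Valued.v (((u : Matrix (Fin 1) (Fin 1) E) 0 0) - 1) ≤ Valued.v (ϖ ^ mstarOfRecord d))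
    (hFN : ∀ f : M, ρ f = f → Θ f = f → Valued.v f = 1 → ∃ z : M, z * Θ z = f)
    (P₁ : GL (Fin 3) E) (hA : formCongr σ P₁ ((StdForm.antidiagonal 3).over E) = (!![H₂ 0 0, 0, H₂ 0 1; 0, hW, 0; H₂ 1 0, 0, H₂ 1 1] : Matrix (Fin 3) (Fin 3) E))
    (hΓ : P₁ * endoGL (γ₂, u) * P₁⁻¹ ∈ unitaryGroupOfForm σ ((StdForm.antidiagonal 3).over E))
    (hs : Valued.v ((γ₂ : Matrix (Fin 2) (Fin 2) E).trace - 2) * Valued.v (ϖ ^ (d % 2)) ≤ Valued.v (ϖ ^ mcOfRecord d))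
    (hp : Valued.v ((γ₂ : Matrix (Fin 2) (Fin 2) E).det - (γ₂ : Matrix (Fin 2) (Fin 2) E).trace + 1) ≤ Valued.v (ϖ ^ mcOfRecord d))
    (J : ℕ)
    (hdich : ∀ j ∈ Finset.range (J + 1), IsOrd ρ α (jE ϖ ^ j) lam → ∀ g₂ : GL (Fin 2) E,
      (latt (g₂ : Matrix (Fin 2) (Fin 2) E)).toAddSubgroup.map φ ∈ levelSet ρ Θ α (jE ϖ) h j 0 →
      IsSelfDualLattice σ ϖ (!![H₂ 0 0, 0, H₂ 0 1; 0, hW, 0; H₂ 1 0, 0, H₂ 1 1] : Matrix (Fin 3) (Fin 3) E) (latt ((endoGL (g₂, (1 : GL (Fin 1) E)) : GL (Fin 3) E) : Matrix (Fin 3) (Fin 3) E)) →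
      mapGL (endoGL (γ₂, u)) (latt ((endoGL (g₂, (1 : GL (Fin 1) E)) : GL (Fin 3) E) : Matrix (Fin 3) (Fin 3) E)) = latt ((endoGL (g₂, (1 : GL (Fin 1) E)) : GL (Fin 3) E) : Matrix (Fin 3) (Fin 3) E) →
      LatticeNearTransvShell ϖ (d % 2) (mcOfRecord d) ((((endoGL (γ₂, u) : GL (Fin 3) E) : Matrix (Fin 3) (Fin 3) E) - 1))
        (latt ((endoGL (g₂, (1 : GL (Fin 1) E)) : GL (Fin 3) E) : Matrix (Fin 3) (Fin 3) E)) →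
      ∃ e : E, σ e = e ∧ Valued.v e = 1 ∧
        {z : E | ∃ y ∈ latt ((endoGL (g₂, (1 : GL (Fin 1) E)) : GL (Fin 3) E) : Matrix (Fin 3) (Fin 3) E), Valued.v ((ϖ ^ (mstarOfRecord d))⁻¹ * (z - pairing σ (!![H₂ 0 0, 0, H₂ 0 1; 0, hW, 0; H₂ 1 0, 0, H₂ 1 1] : Matrix (Fin 3) (Fin 3) E) y (((((endoGL (γ₂, u) : GL (Fin 3) E) : Matrix (Fin 3) (Fin 3) E) - 1)) *ᵥ y))) ≤ 1} = valueSetMod σ ϖ (mstarOfRecord d) (e • xPlus σ ϖ d)) :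
    (∑ j ∈ Finset.range (J + 1), (if IsOrd ρ α (jE ϖ ^ j) lam then
      ((levelSet ρ Θ α (jE ϖ) h j 0 ∩ {Λ | ∃ g₂ : GL (Fin 2) E, (latt (g₂ : Matrix (Fin 2) (Fin 2) E)).toAddSubgroup.map φ = Λ ∧
          (LatticeNearTransvShell ϖ (d % 2) (mstarOfRecord d) ((((endoGL (γ₂, u) : GL (Fin 3) E) : Matrix (Fin 3) (Fin 3) E) - 1)) (latt ((endoGL (g₂, (1 : GL (Fin 1) E)) : GL (Fin 3) E) : Matrix (Fin 3) (Fin 3) E)) ∧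
            {z : E | ∃ y ∈ latt ((endoGL (g₂, (1 : GL (Fin 1) E)) : GL (Fin 3) E) : Matrix (Fin 3) (Fin 3) E), Valued.v ((ϖ ^ (mstarOfRecord d))⁻¹ * (z - pairing σ (!![H₂ 0 0, 0, H₂ 0 1; 0, hW, 0; H₂ 1 0, 0, H₂ 1 1] : Matrix (Fin 3) (Fin 3) E) y (((((endoGL (γ₂, u) : GL (Fin 3) E) : Matrix (Fin 3) (Fin 3) E) - 1)) *ᵥ y))) ≤ 1} = valueSetMod σ ϖ (mstarOfRecord d) (xPlus σ ϖ d))}).ncard : ℤ) -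
        ((levelSet ρ Θ α (jE ϖ) h j 0 ∩ {Λ | ∃ g₂ : GL (Fin 2) E, (latt (g₂ : Matrix (Fin 2) (Fin 2) E)).toAddSubgroup.map φ = Λ ∧
          (LatticeNearTransvShell ϖ (d % 2) (mcOfRecord d) ((((endoGL (γ₂, u) : GL (Fin 3) E) : Matrix (Fin 3) (Fin 3) E) - 1)) (latt ((endoGL (g₂, (1 : GL (Fin 1) E)) : GL (Fin 3) E) : Matrix (Fin 3) (Fin 3) E)) ∧
            ¬ {z : E | ∃ y ∈ latt ((endoGL (g₂, (1 : GL (Fin 1) E)) : GL (Fin 3) E) : Matrix (Fin 3) (Fin 3) E), Valued.v ((ϖ ^ (mstarOfRecord d))⁻¹ * (z - pairing σ (!![H₂ 0 0, 0, H₂ 0 1; 0, hW, 0; H₂ 1 0, 0, H₂ 1 1] : Matrix (Fin 3) (Fin 3) E) y (((((endoGL (γ₂, u) : GL (Fin 3) E) : Matrix (Fin 3) (Fin 3) E) - 1)) *ᵥ y))) ≤ 1} = valueSetMod σ ϖ (mstarOfRecord d) (xPlus σ ϖ d))}).ncard : ℤ)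
      else 0)) = 0 := by
  have hvσ : ∀ a, Valued.v (σ a) = Valued.v a := hD.2.1
  have hϖ : Valued.v ϖ = exp (-1 : ℤ) := hD.2.2.1
  have hvϖ0 : Valued.v ϖ ≠ 0 := by rw [hϖ]; exact exp_ne_zero
  have hϖ0 : ϖ ≠ 0 := fun h0 => by rw [h0, map_zero] at hvϖ0; exact hvϖ0 rfl
  have hϖ1 : Valued.v ϖ ≤ 1 := by rw [hϖ, ← exp_zero, exp_le_exp]; norm_num
  -- the ω-flip from the type-free token `hFN`
  obtain ⟨ε, ξ, hε1, hεξ, hσξ, hξN⟩ := exists_flipUnit_of_forall_fixed_fixed_isNorm σ hD jE hvΘ hΘj hjfix hjpow hFN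
  have hξ1 : Valued.v ξ = 1 := by
    have hjξ : Valued.v (jE ξ) = Valued.v (jE ϖ) ^ (0 : ℤ) := by rw [zpow_zero, ← hεξ, map_mul, hvΘ, hε1, mul_one]
    rw [(hjpow ξ 0).1 hjξ, zpow_zero]
  refine Finset.sum_eq_zero fun j hj => ?_
  split_ifs with hord
  · exact natCast_ncard_axisCell_plus_sub_cleanMinus_eq_zero hD H₂ hhW.le jE hρρ hvρ hα hα1 hint hΘΘ hΘρ hvΘ hjv hjfix hjpow φ hφs hφi hφo hφγ hh hform u hum
      hεξ hσξ hξ1 hξN (d % 2) (mstarOfRecord_le_mcOfRecord d) j 0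
      (hclean_axis_of_frame hD hH₂ hhW jE hρρ hvρ hα hα1 hint hΘΘ hΘρ hvΘ hjv hjfix φ hφs hφi hφγ hlam hh hform u hu1 P₁ hA hΓ hs hp hord)
      (fun g₂ hmem hsh => hdich j hj hord g₂ hmem
        (isSelfDualLattice_latt_endoGL_one_of_mem_levelSet_zero hvσ hϖ0 hϖ1 hH₂ hhW jE hρρ hvρ hα hα1 hint hΘΘ hΘρ hvΘ hjv hjfix φ hφi hh hform hmem)
        (mapGL_endoGL_latt_endoGL_one_eq_of_isOrd jE hρρ hvρ hα hα1 hint hjv hjfix φ hφs hφi hφγ hlam u hu1 hord hmem) hsh)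
  · rfl

/-! ## §4 The hyperbolic literal spelled out (`H₂ = Φ₂`, `h_W = 1`, `P₁ = 1`) -/

omit [Valued E ℤᵐ⁰] in
/-- The hyperbolic block form `ι-shape(Φ₂, 1)` is the identity-frame congruent of `Φ₃`: `formCongr σ 1 Φ₃ = ι-shape(Φ₂, 1)` (both are `antidiag(1, 1, 1)`). [cite: Jacobowitz1962, §4] -/
theorem formCongr_one_antidiagonal_three_eq_endoShape_two (σ : E →+* E) :
    formCongr σ (1 : GL (Fin 3) E) ((StdForm.antidiagonal 3).over E) =
      (!![((StdForm.antidiagonal 2).over E) 0 0, 0, ((StdForm.antidiagonal 2).over E) 0 1; 0, (1 : E), 0; ((StdForm.antidiagonal 2).over E) 1 0, 0, ((StdForm.antidiagonal 2).over E) 1 1] : Matrix (Fin 3) (Fin 3) E) := by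
  rw [formCongr_one_eq]
  ext i j
  fin_cases i <;> fin_cases j <;> simp [StdForm.over, Fin.rev]

/-- **(AX-Σ) AT THE HYPERBOLIC LITERAL** — `sum_ite_isOrd_axisCellDiff_eq_zero_of_frame` with `H₂ := Φ₂`, `h_W := 1`, `P₁ := 1` (`det Φ₂ = −1` a unit, ★ `det_antidiagonal_two`;
`formCongr σ 1 Φ₃ = ι-shape(Φ₂, 1)`; `Γ = ι(γ₂, u) ∈ U(σ, Φ₃)` as is): the axis column of the HYP literal of ★ `beta2Cells{A,B,C}Frame` is `0`, modulo `hdich`.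
[cite: Kottwitz1986BaseChangeUnits, §1 pp. 240–241] [cite: Rogawski1990, §4.9 Prop. 4.9.1 (b) p. 55] [cite: Serre1979, Ch. V §3 Cor. 3] [cite: Jacobowitz1962, §4, §7] -/
theorem sum_ite_isOrd_axisCellDiff_eq_zero_hyp [CompleteSpace E] [Finite 𝓀[E]] (hD : IsRamifiedQuadraticDatum σ ϖ d t)
    (jE : E →+* M)
    (hρρ : ∀ x, ρ (ρ x) = x) (hvρ : ∀ x, Valued.v (ρ x) = Valued.v x) (hα : ρ α ≠ α) (hα1 : Valued.v α ≤ 1)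
    (hint : ∀ z : M, Valued.v z ≤ 1 → Valued.v ((z - ρ z) / (α - ρ α)) ≤ 1)
    (hΘΘ : ∀ x, Θ (Θ x) = x) (hΘρ : ∀ x, Θ (ρ x) = ρ (Θ x)) (hvΘ : ∀ x, Valued.v (Θ x) = Valued.v x) (hΘj : ∀ x, Θ (jE x) = jE (σ x))
    (hjv : ∀ c, Valued.v (jE c) ≤ 1 ↔ Valued.v c ≤ 1) (hjfix : ∀ z, ρ z = z ↔ ∃ c, jE c = z)
    (hjpow : ∀ (t : E) (n : ℤ), Valued.v (jE t) = Valued.v (jE ϖ) ^ n ↔ Valued.v t = Valued.v ϖ ^ n)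
    (φ : (Fin 2 → E) →+ M) (hφs : ∀ (c : E) (x : Fin 2 → E), φ (c • x) = jE c * φ x) (hφi : Function.Injective φ) (hφo : Function.Surjective φ)
    {γ₂ : GL (Fin 2) E} {lam h : M} (hφγ : ∀ x, φ ((γ₂ : Matrix (Fin 2) (Fin 2) E).mulVec x) = lam * φ x) (hlam : Valued.v lam = 1)
    (hh : h ≠ 0) (hform : ∀ x y, jE (pairing σ ((StdForm.antidiagonal 2).over E) x y) = h * Θ (φ x) * φ y + ρ (h * Θ (φ x) * φ y))
    (u : GL (Fin 1) E) (hu1 : Valued.v ((u : Matrix (Fin 1) (Fin 1) E) 0 0) = 1) (hum : Valued.v (((u : Matrix (Fin 1) (Fin 1) E) 0 0) - 1) ≤ Valued.v (ϖ ^ mstarOfRecord d))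
    (hFN : ∀ f : M, ρ f = f → Θ f = f → Valued.v f = 1 → ∃ z : M, z * Θ z = f)
    (hΓ : endoGL (γ₂, u) ∈ unitaryGroupOfForm σ ((StdForm.antidiagonal 3).over E))
    (hs : Valued.v ((γ₂ : Matrix (Fin 2) (Fin 2) E).trace - 2) * Valued.v (ϖ ^ (d % 2)) ≤ Valued.v (ϖ ^ mcOfRecord d))
    (hp : Valued.v ((γ₂ : Matrix (Fin 2) (Fin 2) E).det - (γ₂ : Matrix (Fin 2) (Fin 2) E).trace + 1) ≤ Valued.v (ϖ ^ mcOfRecord d))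
    (J : ℕ)
    (hdich : ∀ j ∈ Finset.range (J + 1), IsOrd ρ α (jE ϖ ^ j) lam → ∀ g₂ : GL (Fin 2) E,
      (latt (g₂ : Matrix (Fin 2) (Fin 2) E)).toAddSubgroup.map φ ∈ levelSet ρ Θ α (jE ϖ) h j 0 →
      IsSelfDualLattice σ ϖ (!![((StdForm.antidiagonal 2).over E) 0 0, 0, ((StdForm.antidiagonal 2).over E) 0 1; 0, (1 : E), 0; ((StdForm.antidiagonal 2).over E) 1 0, 0, ((StdForm.antidiagonal 2).over E) 1 1] : Matrix (Fin 3) (Fin 3) E) (latt ((endoGL (g₂, (1 : GL (Fin 1) E)) : GL (Fin 3) E) : Matrix (Fin 3) (Fin 3) E)) →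
      mapGL (endoGL (γ₂, u)) (latt ((endoGL (g₂, (1 : GL (Fin 1) E)) : GL (Fin 3) E) : Matrix (Fin 3) (Fin 3) E)) = latt ((endoGL (g₂, (1 : GL (Fin 1) E)) : GL (Fin 3) E) : Matrix (Fin 3) (Fin 3) E) →
      LatticeNearTransvShell ϖ (d % 2) (mcOfRecord d) ((((endoGL (γ₂, u) : GL (Fin 3) E) : Matrix (Fin 3) (Fin 3) E) - 1))
        (latt ((endoGL (g₂, (1 : GL (Fin 1) E)) : GL (Fin 3) E) : Matrix (Fin 3) (Fin 3) E)) →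
      ∃ e : E, σ e = e ∧ Valued.v e = 1 ∧
        {z : E | ∃ y ∈ latt ((endoGL (g₂, (1 : GL (Fin 1) E)) : GL (Fin 3) E) : Matrix (Fin 3) (Fin 3) E), Valued.v ((ϖ ^ (mstarOfRecord d))⁻¹ * (z - pairing σ (!![((StdForm.antidiagonal 2).over E) 0 0, 0, ((StdForm.antidiagonal 2).over E) 0 1; 0, (1 : E), 0; ((StdForm.antidiagonal 2).over E) 1 0, 0, ((StdForm.antidiagonal 2).over E) 1 1] : Matrix (Fin 3) (Fin 3) E) y (((((endoGL (γ₂, u) : GL (Fin 3) E) : Matrix (Fin 3) (Fin 3) E) - 1)) *ᵥ y))) ≤ 1} = valueSetMod σ ϖ (mstarOfRecord d) (e • xPlus σ ϖ d)) :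
    (∑ j ∈ Finset.range (J + 1), (if IsOrd ρ α (jE ϖ ^ j) lam then
      ((levelSet ρ Θ α (jE ϖ) h j 0 ∩ {Λ | ∃ g₂ : GL (Fin 2) E, (latt (g₂ : Matrix (Fin 2) (Fin 2) E)).toAddSubgroup.map φ = Λ ∧
          (LatticeNearTransvShell ϖ (d % 2) (mstarOfRecord d) ((((endoGL (γ₂, u) : GL (Fin 3) E) : Matrix (Fin 3) (Fin 3) E) - 1)) (latt ((endoGL (g₂, (1 : GL (Fin 1) E)) : GL (Fin 3) E) : Matrix (Fin 3) (Fin 3) E)) ∧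
            {z : E | ∃ y ∈ latt ((endoGL (g₂, (1 : GL (Fin 1) E)) : GL (Fin 3) E) : Matrix (Fin 3) (Fin 3) E), Valued.v ((ϖ ^ (mstarOfRecord d))⁻¹ * (z - pairing σ (!![((StdForm.antidiagonal 2).over E) 0 0, 0, ((StdForm.antidiagonal 2).over E) 0 1; 0, (1 : E), 0; ((StdForm.antidiagonal 2).over E) 1 0, 0, ((StdForm.antidiagonal 2).over E) 1 1] : Matrix (Fin 3) (Fin 3) E) y (((((endoGL (γ₂, u) : GL (Fin 3) E) : Matrix (Fin 3) (Fin 3) E) - 1)) *ᵥ y))) ≤ 1} = valueSetMod σ ϖ (mstarOfRecord d) (xPlus σ ϖ d))}).ncard : ℤ) -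
        ((levelSet ρ Θ α (jE ϖ) h j 0 ∩ {Λ | ∃ g₂ : GL (Fin 2) E, (latt (g₂ : Matrix (Fin 2) (Fin 2) E)).toAddSubgroup.map φ = Λ ∧
          (LatticeNearTransvShell ϖ (d % 2) (mcOfRecord d) ((((endoGL (γ₂, u) : GL (Fin 3) E) : Matrix (Fin 3) (Fin 3) E) - 1)) (latt ((endoGL (g₂, (1 : GL (Fin 1) E)) : GL (Fin 3) E) : Matrix (Fin 3) (Fin 3) E)) ∧
            ¬ {z : E | ∃ y ∈ latt ((endoGL (g₂, (1 : GL (Fin 1) E)) : GL (Fin 3) E) : Matrix (Fin 3) (Fin 3) E), Valued.v ((ϖ ^ (mstarOfRecord d))⁻¹ * (z - pairing σ (!![((StdForm.antidiagonal 2).over E) 0 0, 0, ((StdForm.antidiagonal 2).over E) 0 1; 0, (1 : E), 0; ((StdForm.antidiagonal 2).over E) 1 0, 0, ((StdForm.antidiagonal 2).over E) 1 1] : Matrix (Fin 3) (Fin 3) E) y (((((endoGL (γ₂, u) : GL (Fin 3) E) : Matrix (Fin 3) (Fin 3) E) - 1)) *ᵥ y))) ≤ 1} = valueSetMod σ ϖ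 (mstarOfRecord d) (xPlus σ ϖ d))}).ncard : ℤ)
      else 0)) = 0 :=
  sum_ite_isOrd_axisCellDiff_eq_zero_of_frame hD (by rw [det_antidiagonal_two]; exact isUnit_one.neg) (map_one _) jE hρρ hvρ hα hα1 hint hΘΘ hΘρ hvΘ hΘj hjv hjfix hjpow
    φ hφs hφi hφo hφγ hlam hh hform u hu1 hum hFN 1 (formCongr_one_antidiagonal_three_eq_endoShape_two σ) (by rwa [one_mul, inv_one, mul_one]) hs hp J hdich

end Summit.HodgeConjecture.HodgeConjecture.Cruxes.H413.F0P3cDyRamAxisColumnZeroOfFrame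

end
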